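import Summits.RiemannHypothesis.RiemannHypothesis.Theorems.SpectralTraceWindowTraceArchStubDisplacementBoundAux
import HarnessLib

/-!
# From counting to displacement (`stub_displacementBound`)

Stub `stub_displacementBound` of the line `defect-compactness-design` (wave 2, structure of
witnesses) for the crux `WindowTraceArch` (stmt-RiemannHypothesis-11195; skeleton
`Summit.RiemannHypothesis.RiemannHypothesis.Cruxes.WindowTraceArch.DefectCompactnessDesign`).

**Statement.** Let `a : ℕ → ℝ` be non-decreasing and non-negative with the counting law
`|#{n : a n ≤ T} − θ(T)/π| ≤ C(1 + log(1+T))` for all `T ≥ 0` (`θ = riemannSiegelTheta`; the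
sub-level sets being finite), and let `p : ℕ → ℝ` be strictly increasing with `p n ≥ 7` and
`θ(p n) = (n − ½)π` (the positive França–LeClair points in increasing order). Then
`sup_n |a n − p n| < ∞`.

**Proof.** (Aux file: `p m ≤ 100 + 7m`, `θ'(p m) ≥ (log m)/4 − 3` for `m ≥ 1`,
`(p m' − p m) θ'(p m) ≤ (m' − m)π` for `m ≤ m'`, and `a j ≤ T ↔ j < #{n : a n ≤ T}`.)
The counting law at `T = p m` (where `θ(p m)/π = m − ½`) gives the two comparison principles
`(m − ½) + C(1 + log(1 + p m)) ≤ j ⇒ p m < a j` and `j + 1 ≤ (m − ½) − C(1 + log(1 + p m)) ⇒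
a j ≤ p m`. For large `n` put `k = ⌈C(1 + log(101 + 14n)) + 3/2⌉ ≤ M log n ≤ n/2`
(`M = C(2 + log 115) + 5/2`, `n ≥ 16M²`); then `p (n−k) < a n ≤ p (n+k)` (both `p (n∓k) ≤ 100 + 14n`),
so `|a n − p n| ≤ p (n+k) − p (n−k) ≤ 2kπ/θ'(p (n−k)) ≤ 2kπ · 8/log n ≤ 16πM` once `log n ≥ 26`
(`θ'(p (n−k)) ≥ (log(n/2))/4 − 3 ≥ (log n)/8`). The finitely many small `n` are absorbed into the
constant.

**Sources.** G. França, A. LeClair, Commun. Number Theory Phys. 9 (2015), eq. (18)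
(arXiv:1502.06003); E. C. Titchmarsh, *The Theory of the Riemann Zeta-Function* (1986), §9.3
(from `N(T)` to the ordinates, `S(T) = O(log T)`); H. M. Edwards, *Riemann's Zeta Function* (1974),
§6.5. All ingredients are proved tree / Mathlib facts; the argument is elementary. [folklore]
-/

set_option linter.dupNamespace false

noncomputable section

open Set Filter
open scoped Real Topology BigOperators

namespace Summit.RiemannHypothesis.RiemannHypothesis.Theorems.SpectralTraceWindowTraceArch

open Literature.NumberTheory.LFunctions

/-! ## An elementary growth lemma -/

/-- `M log x ≤ x/2` for `x ≥ max(1, 16M²)`, `M ≥ 0` (`log x ≤ 2√x`). [folklore] -/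
theorem stub_displacementBound_log_le_half {M x : ℝ} (hM : 0 ≤ M) (hx : 1 ≤ x)
    (hMx : 16 * M ^ 2 ≤ x) : M * Real.log x ≤ x / 2 := by
  have hx0 : 0 ≤ x := by linarith
  have hs0 : 0 ≤ Real.sqrt x := Real.sqrt_nonneg x
  have hlog : Real.log x ≤ 2 * Real.sqrt x := by
    have h1 : Real.log (Real.sqrt x) ≤ Real.sqrt x - 1 :=
      Real.log_le_sub_one_of_pos (Real.sqrt_pos.2 (by linarith))
    rw [Real.log_sqrt hx0] at h1
    linarith
  have h4M : 4 * M ≤ Real.sqrt x := by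
    rw [Real.le_sqrt (by positivity) hx0]; nlinarith
  calc M * Real.log x ≤ M * (2 * Real.sqrt x) := mul_le_mul_of_nonneg_left hlog hM
    _ = (4 * M) * Real.sqrt x / 2 := by ring
    _ ≤ Real.sqrt x * Real.sqrt x / 2 :=
        div_le_div_of_nonneg_right (mul_le_mul_of_nonneg_right h4M hs0) (by norm_num)
    _ = x / 2 := by rw [Real.mul_self_sqrt hx0]

/-! ## The two comparison principles from the counting law at `T = p m` -/

/-- **(α)** If `(m − ½) + C(1 + log(1 + p m)) ≤ j` then `p m < a j`: the counting law at `T = p m`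
gives `#{n : a n ≤ p m} ≤ m − ½ + C(1 + log(1 + p m)) ≤ j`, and the sub-level set is the initial
segment of length `#`. [folklore] -/
theorem stub_displacementBound_lt_of_le {a p : ℕ → ℝ} {C : ℝ} (ha : Monotone a)
    (hp7 : ∀ n, 7 ≤ p n)
    (hθp : ∀ n : ℕ, riemannSiegelTheta (p n) = ((n : ℝ) - 1 / 2) * Real.pi)
    (hcount : ∀ T : ℝ, 0 ≤ T → {n : ℕ | a n ≤ T}.Finite ∧
      |(({n : ℕ | a n ≤ T}.ncard : ℕ) : ℝ) - riemannSiegelTheta T / Real.pi| ≤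
        C * (1 + Real.log (1 + T)))
    {m j : ℕ} (h : (m : ℝ) - 1 / 2 + C * (1 + Real.log (1 + p m)) ≤ j) : p m < a j := by
  obtain ⟨hfin, habs⟩ := hcount (p m) (by linarith [hp7 m])
  have hq : riemannSiegelTheta (p m) / Real.pi = (m : ℝ) - 1 / 2 := by
    rw [hθp m, mul_div_assoc, div_self Real.pi_ne_zero, mul_one]
  rw [hq] at habs
  have h1 := (abs_le.1 habs).2
  have h2 : (({n : ℕ | a n ≤ p m}.ncard : ℕ) : ℝ) ≤ j := by linarith
  have h3 : {n : ℕ | a n ≤ p m}.ncard ≤ j := by exact_mod_cast h2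
  have h4 : ¬ (a j ≤ p m) := fun hj =>
    absurd ((stub_displacementBound_le_iff_lt_ncard ha hfin j).1 hj) (not_lt.2 h3)
  exact not_le.1 h4

/-- **(β)** If `j + 1 ≤ (m − ½) − C(1 + log(1 + p m))` then `a j ≤ p m`: the counting law at
`T = p m` gives `#{n : a n ≤ p m} ≥ m − ½ − C(1 + log(1 + p m)) ≥ j + 1`. [folklore] -/
theorem stub_displacementBound_le_of_le {a p : ℕ → ℝ} {C : ℝ} (ha : Monotone a)
    (hp7 : ∀ n, 7 ≤ p n)
    (hθp : ∀ n : ℕ, riemannSiegelTheta (p n) = ((n : ℝ) - 1 / 2) * Real.pi)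
    (hcount : ∀ T : ℝ, 0 ≤ T → {n : ℕ | a n ≤ T}.Finite ∧
      |(({n : ℕ | a n ≤ T}.ncard : ℕ) : ℝ) - riemannSiegelTheta T / Real.pi| ≤
        C * (1 + Real.log (1 + T)))
    {m j : ℕ} (h : (j : ℝ) + 1 ≤ (m : ℝ) - 1 / 2 - C * (1 + Real.log (1 + p m))) :
    a j ≤ p m := by
  obtain ⟨hfin, habs⟩ := hcount (p m) (by linarith [hp7 m])
  have hq : riemannSiegelTheta (p m) / Real.pi = (m : ℝ) - 1 / 2 := by
    rw [hθp m, mul_div_assoc, div_self Real.pi_ne_zero, mul_one]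
  rw [hq] at habs
  have h1 := (abs_le.1 habs).1
  have h2 : (j : ℝ) + 1 ≤ (({n : ℕ | a n ≤ p m}.ncard : ℕ) : ℝ) := by linarith
  have h3 : j + 1 ≤ {n : ℕ | a n ≤ p m}.ncard := by exact_mod_cast h2
  exact (stub_displacementBound_le_iff_lt_ncard ha hfin j).2 (Nat.lt_iff_add_one_le.mpr h3)

/-! ## The stub -/

/-- **stub_displacementBound — from counting to displacement.** Let `a : ℕ → ℝ` be non-decreasing
and non-negative with the counting law `#{n : a n ≤ T} = θ(T)/π + O(log(1+T))` (`T ≥ 0`), and let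
`p : ℕ → ℝ` be the positive França–LeClair points in increasing order: `p` strictly increasing,
`p n ≥ 7`, `θ(p n) = (n − ½)π`. Then `sup_n |a n − p n| < ∞`. Proof: sandwich
`p (n − k) < a n ≤ p (n + k)` with `k = O(log n)` from the counting law at the lattice points, and
gaps `p (n+k) − p (n−k) ≤ 2kπ/θ'(p (n−k))` with `θ'(p (n−k)) ≫ log n`. [folklore] -/
theorem stub_displacementBound :
    ∀ (a p : ℕ → ℝ) (C : ℝ), Monotone a → (∀ n, 0 ≤ a n) → StrictMono p → (∀ n, 7 ≤ p n) →
      (∀ n : ℕ, Literature.NumberTheory.LFunctions.riemannSiegelTheta (p n) = ((n : ℝ) - 1 / 2) * Real.pi) →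
      (∀ T : ℝ, 0 ≤ T → {n : ℕ | a n ≤ T}.Finite ∧
        |(({n : ℕ | a n ≤ T}.ncard : ℕ) : ℝ) -
            Literature.NumberTheory.LFunctions.riemannSiegelTheta T / Real.pi| ≤ C * (1 + Real.log (1 + T))) →
      ∃ D : ℝ, ∀ n, |a n - p n| ≤ D := by
  intro a p C ha _ hp hp7 hθp hcount
  obtain ⟨hple, hderiv, hgap⟩ := stub_displacementBound_lattice p hp hp7 hθp
  have hπ : 0 < Real.pi := Real.pi_pos
  -- `C ≥ 0` (the counting law at `T = 0`)
  have hC : 0 ≤ C := by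
    obtain ⟨-, h0⟩ := hcount 0 le_rfl
    have h1 : C * (1 + Real.log (1 + 0)) = C := by simp
    rw [h1] at h0
    exact (abs_nonneg _).trans h0
  -- the slope constant `M`
  have hl0 : 0 ≤ Real.log 115 := Real.log_nonneg (by norm_num)
  obtain ⟨M, hM0, hMb⟩ : ∃ M : ℝ, 0 ≤ M ∧
      ∀ L : ℝ, 1 ≤ L → C * (1 + Real.log 115 + L) + 5 / 2 ≤ M * L := by
    refine ⟨C * (2 + Real.log 115) + 5 / 2, by positivity, fun L hL => ?_⟩
    have h1 : C * (1 + Real.log 115) * 1 ≤ C * (1 + Real.log 115) * L :=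
      mul_le_mul_of_nonneg_left hL (by positivity)
    nlinarith
  -- the threshold `n₀`
  obtain ⟨n₀, hn₀1, hn₀2⟩ : ∃ n₀ : ℕ, 16 * M ^ 2 ≤ (n₀ : ℝ) ∧ Real.exp 26 ≤ (n₀ : ℝ) := by
    refine ⟨max ⌈16 * M ^ 2⌉₊ ⌈Real.exp 26⌉₊, ?_, ?_⟩
    · exact (Nat.le_ceil _).trans (by exact_mod_cast le_max_left _ _)
    · exact (Nat.le_ceil _).trans (by exact_mod_cast le_max_right _ _)
  -- the bound for `n ≥ n₀`
  have hev : ∀ n : ℕ, n₀ ≤ n → |a n - p n| ≤ 16 * Real.pi * M := by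
    intro n hn
    have hn' : (n₀ : ℝ) ≤ n := by exact_mod_cast hn
    have hn1 : 16 * M ^ 2 ≤ (n : ℝ) := hn₀1.trans hn'
    have hn2 : Real.exp 26 ≤ (n : ℝ) := hn₀2.trans hn'
    have h27 : (27 : ℝ) ≤ n := le_trans (by linarith [Real.add_one_le_exp (26 : ℝ)]) hn2
    have hn0 : (0 : ℝ) < n := by linarith
    have hL : 26 ≤ Real.log (n : ℝ) := by
      have h1 := Real.log_le_log (Real.exp_pos 26) hn2
      rwa [Real.log_exp] at h1
    -- the shift `k`
    have hE0 : 0 ≤ C * (1 + Real.log (101 + 14 * (n : ℝ))) :=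
      mul_nonneg hC (by linarith [Real.log_nonneg (show (1 : ℝ) ≤ 101 + 14 * (n : ℝ) by linarith)])
    have hk1 := Nat.le_ceil (C * (1 + Real.log (101 + 14 * (n : ℝ))) + 3 / 2)
    have hk2 := Nat.ceil_lt_add_one (show (0 : ℝ) ≤ C * (1 + Real.log (101 + 14 * (n : ℝ))) + 3 / 2
      by linarith)
    generalize ⌈C * (1 + Real.log (101 + 14 * (n : ℝ))) + 3 / 2⌉₊ = k at hk1 hk2
    have hlog14 : Real.log (101 + 14 * (n : ℝ)) ≤ Real.log 115 + Real.log (n : ℝ) := by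
      have h1 : (101 + 14 * (n : ℝ)) ≤ 115 * n := by linarith
      have h2 := Real.log_le_log (by linarith) h1
      rwa [Real.log_mul (by norm_num) hn0.ne'] at h2
    have hkM : (k : ℝ) ≤ M * Real.log (n : ℝ) := by
      have h1 : C * (1 + Real.log (101 + 14 * (n : ℝ))) ≤
          C * (1 + Real.log 115 + Real.log (n : ℝ)) :=
        mul_le_mul_of_nonneg_left (by linarith) hC
      have h2 := hMb (Real.log (n : ℝ)) (by linarith)
      linarith
    have hML : M * Real.log (n : ℝ) ≤ n / 2 :=
      stub_displacementBound_log_le_half hM0 (by linarith) hn1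
    have hkn2 : (k : ℝ) ≤ n / 2 := hkM.trans hML
    have hk0 : (0 : ℝ) ≤ k := Nat.cast_nonneg k
    have hkn : k ≤ n := by
      have h1 : (k : ℝ) ≤ n := by linarith
      exact_mod_cast h1
    -- `m₁ = n - k`, `m₂ = n + k`
    have hm1cast : ((n - k : ℕ) : ℝ) = n - k := Nat.cast_sub hkn
    have hm1ge : (n : ℝ) / 2 ≤ ((n - k : ℕ) : ℝ) := by rw [hm1cast]; linarith
    have hm1one : 1 ≤ n - k := by
      have h1 : (1 : ℝ) ≤ ((n - k : ℕ) : ℝ) := by rw [hm1cast]; linarith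
      exact_mod_cast h1
    have hp1 : p (n - k) ≤ 100 + 14 * n := by
      have h1 := hple (n - k)
      rw [hm1cast] at h1
      linarith
    have hp2 : p (n + k) ≤ 100 + 14 * n := by
      have h1 := hple (n + k)
      push_cast at h1
      linarith
    have hE : ∀ m : ℕ, p m ≤ 100 + 14 * n →
        C * (1 + Real.log (1 + p m)) ≤ (k : ℝ) - 3 / 2 := by
      intro m hm
      have h7 := hp7 m
      have h1 : Real.log (1 + p m) ≤ Real.log (101 + 14 * (n : ℝ)) :=
        Real.log_le_log (by linarith) (by linarith)
      have h2 : C * (1 + Real.log (1 + p m)) ≤ C * (1 + Real.log (101 + 14 * (n : ℝ))) :=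
        mul_le_mul_of_nonneg_left (by linarith) hC
      linarith
    -- the sandwich `p (n - k) < a n ≤ p (n + k)`
    have hlow : p (n - k) < a n := by
      refine stub_displacementBound_lt_of_le ha hp7 hθp hcount ?_
      rw [hm1cast]
      have h1 := hE (n - k) hp1
      linarith
    have hupp : a n ≤ p (n + k) := by
      refine stub_displacementBound_le_of_le ha hp7 hθp hcount ?_
      push_cast
      have h1 := hE (n + k) hp2
      linarith
    have hpn1 : p (n - k) ≤ p n := hp.monotone (Nat.sub_le n k)
    have hpn2 : p n ≤ p (n + k) := hp.monotone (Nat.le_add_right n k)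
    -- the gap `p (n + k) - p (n - k) ≤ 16 π M`
    have hg := hgap (n - k) (n + k) (by omega)
    rw [hm1cast] at hg
    push_cast at hg
    have hθ' : Real.log (n : ℝ) / 8 ≤ riemannSiegelThetaDeriv (p (n - k)) := by
      have h1 := hderiv (n - k) hm1one
      have h2 : Real.log ((n : ℝ) / 2) ≤ Real.log ((n - k : ℕ) : ℝ) :=
        Real.log_le_log (by positivity) hm1ge
      rw [Real.log_div hn0.ne' two_ne_zero] at h2
      have h3 : Real.log 2 < 0.6931471808 := Real.log_two_lt_d9
      linarith
    have hLpos : 0 < Real.log (n : ℝ) / 8 := by linarith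
    have hdiff : p (n + k) - p (n - k) ≤ 16 * Real.pi * M := by
      have hd0 : 0 ≤ p (n + k) - p (n - k) := by linarith
      have h1 : (p (n + k) - p (n - k)) * (Real.log (n : ℝ) / 8) ≤
          (16 * Real.pi * M) * (Real.log (n : ℝ) / 8) :=
        calc (p (n + k) - p (n - k)) * (Real.log (n : ℝ) / 8)
            ≤ (p (n + k) - p (n - k)) * riemannSiegelThetaDeriv (p (n - k)) :=
              mul_le_mul_of_nonneg_left hθ' hd0
          _ ≤ ((n : ℝ) + k - (n - k)) * Real.pi := hg
          _ = 2 * (k : ℝ) * Real.pi := by ring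
          _ ≤ 2 * (M * Real.log (n : ℝ)) * Real.pi := by nlinarith
          _ = (16 * Real.pi * M) * (Real.log (n : ℝ) / 8) := by ring
      exact le_of_mul_le_mul_right h1 hLpos
    rw [abs_le]
    constructor <;> linarith
  -- assemble: the finitely many `n < n₀` are absorbed into the constant
  refine ⟨max (16 * Real.pi * M) (∑ i ∈ Finset.range n₀, |a i - p i|), fun n => ?_⟩
  rcases lt_or_ge n n₀ with hn | hn
  · refine le_trans ?_ (le_max_right _ _)
    exact Finset.single_le_sum (f := fun i => |a i - p i|) (fun i _ => abs_nonneg _)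
      (Finset.mem_range.2 hn)
  · exact (hev n hn).trans (le_max_left _ _)

end Summit.RiemannHypothesis.RiemannHypothesis.Theorems.SpectralTraceWindowTraceArch

end
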